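import Literature.NumberTheory.EllipticCurves.CMFormalActionTaylorProofs
import Literature.NumberTheory.EllipticCurves.FormalGroupTranslationTaylorYProofs
import HarnessLib

/-!
# The CM transformation identity on the formal group, `y`-coordinate: `α·ỹ(ξ(α(Ω+v)))·Q² = (P′Q − PQ′)·ỹ(ξ(Ω+v))`
# by formal differentiation of the `x`-identity (Silverman AT II.1.1, de Shalit II.1.10 / II.4.9 — proofs only)

Topic `NumberTheory/EllipticCurves` (theorems only; no definition, no named fact, no instance).  Sequel of `CMFormalActionTaylorProofs`
(★★ `rescale_translateX_subst_formalExp_mul_aeval_eq`: `(rescale α TX₁ + C b)·Q(TX₀ + C b) = P(TX₀ + C b)`, `TXᵢ = translateX ∘ exp_W` at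
`ξ(Ω)`, `ξ(αΩ)`) and `FormalGroupTranslationTaylorYProofs` (`𝓣[y(ξ(Ω + ·))] = translateY ∘ exp_W`).  With `ỹ := 2y + a₁x + a₃ = ℘′`:

* (private `derivative_rescale_C_mul` — `d/dz (f(αz)) = α·f′(αz)`, the `C a * _` form of the tree's `derivative_rescale`);
* ★ `derivative_translateX_subst_formalExp` — **`d/dz (translateX ∘ exp_W) = 2·translateY ∘ exp_W + a₁·translateX ∘ exp_W + a₃`** (the
  invariant derivative `dx/ω = 2y + a₁x + a₃` on the translate, in the logarithmic coordinate `z`; from `℘′ = ỹ ∘ ξ` and the two Taylor theorems);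
* ★★★ `rescale_translateY_cm_identity` — differentiating the `x`-identity:
  **`α·(2·rescale α TY₁ + a₁·rescale α TX₁ + a₃)·Q(S) + (rescale α TX₁ + b)·Q′(S)·(2TY₀ + a₁TX₀ + a₃) = P′(S)·(2TY₀ + a₁TX₀ + a₃)`**,
  `S = TX₀ + C b` — i.e. `α·℘′(α(Ω+v))·Q(℘)² = (P′Q − PQ′)(℘)·℘′(Ω+v)` read on the Taylor series: the `y`-coordinate of the algebraic
  multiplication `[α]` (chart `y ↦ (P′Q − PQ′)(℘)·y/(αQ²)`, `CMEndomorphismOfCertificate.exists_map_some_eq_toPoint_mul`) agrees with the formal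
  `[α]_Ê` on the translate through `P₁ = ξ(Ω)` — ingredient (CM-POINTS)(ii) of the cell's CM bridge, `y`-half, logarithmic coordinate.

Cell `bsd-print-cf2`, width seat `bsd-line-cf2c-w4` g14; no summit statement is proved; BSD is not proved by any of this.

## References
* [SilvermanATAEC1994] J. H. Silverman, *Advanced Topics in the Arithmetic of Elliptic Curves* (1994), II Prop. 1.1, §II.2.
* [deShalit1987] E. de Shalit, *Iwasawa theory of elliptic curves with complex multiplication* (1987), II §1.10, §4.9.
* [Cox2013] D. A. Cox, *Primes of the form x² + ny²*, 2nd ed. (2013), Prop. 14.9.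
* [SilvermanAEC2009] J. H. Silverman, *The Arithmetic of Elliptic Curves*, 2nd ed. (2009), III.1, IV.1, VI.3.6.
-/

noncomputable section

open PowerSeries Filter Set Literature.NumberTheory.Transcendental.AndreCriterion
open scoped Topology Nat Classical

/-- The Taylor series of `f : ℂ → ℂ` at `0` (local notation, as in `AndreCriterionAnalyticProofs`). -/
local notation3 "𝓣[" f "]" =>
  (PowerSeries.mk fun n => ((Nat.factorial n : ℂ)⁻¹ * iteratedDeriv n f 0) : PowerSeries ℂ)

namespace WeierstrassCurve

open PeriodPair Literature.NumberTheory.EllipticCurves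

/-- **`d/dz f(αz) = α·f′(αz)`**: `d⁄dX (rescale a f) = C a · rescale a (d⁄dX f)` (the `C a * _` form of
`Literature.NumberTheory.EllipticCurves.derivative_rescale` of `FormalGroupMultiplicationParityProofs`, kept private to keep the imports small).
[cite: SilvermanAEC2009, IV.1] -/
private theorem derivative_rescale_C_mul {R : Type*} [CommRing R] (a : R) (f : PowerSeries R) :
    d⁄dX R (rescale a f) = C a * rescale a (d⁄dX R f) := by
  ext n
  rw [coeff_derivative, coeff_rescale, coeff_C_mul, coeff_rescale, coeff_derivative, pow_succ]
  ring

/-- `rescale a (C r) = C r`. [cite: SilvermanAEC2009, IV.1] -/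
private theorem rescale_C' {R : Type*} [CommRing R] (a r : R) : rescale a (C r) = C r := by
  ext n
  rw [coeff_rescale, coeff_C]
  split_ifs with h
  · subst h; simp
  · rw [mul_zero]

variable (L : PeriodPair) (W : WeierstrassCurve ℂ)

/-- `d/dv x(ξ(Ω + v)) = ℘′(Ω + v) = 2y + a₁x + a₃` at `ξ(Ω + v)`, as Taylor series:
`d⁄dz 𝓣[x(ξ(Ω+·))] = 2·𝓣[y(ξ(Ω+·))] + a₁·𝓣[x(ξ(Ω+·))] + a₃`. [cite: SilvermanAEC2009, III.1, VI.3.6] -/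
theorem derivative_taylor_x_translate {Ω : ℂ} (hΩ : Ω ∉ L.lattice) :
    d⁄dX ℂ 𝓣[fun v => ℘[L] (Ω + v) - W.b₂ / 12] =
      2 * 𝓣[fun v => (℘'[L] (Ω + v) - W.a₁ * (℘[L] (Ω + v) - W.b₂ / 12) - W.a₃) / 2] +
        C W.a₁ * 𝓣[fun v => ℘[L] (Ω + v) - W.b₂ / 12] + C W.a₃ := by
  rw [← taylor_deriv]
  -- `deriv (x ∘ ξ(Ω + ·)) = ℘′(Ω + ·)` near `0`
  have hev : deriv (fun v => ℘[L] (Ω + v) - W.b₂ / 12) =ᶠ[𝓝 0] fun v =>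
      2 * ((℘'[L] (Ω + v) - W.a₁ * (℘[L] (Ω + v) - W.b₂ / 12) - W.a₃) / 2) + W.a₁ * (℘[L] (Ω + v) - W.b₂ / 12) + W.a₃ := by
    filter_upwards [eventually_const_add_notMem_lattice L hΩ] with v hv
    have h℘ : HasDerivAt ℘[L] (℘'[L] (Ω + v)) (Ω + v) := by
      rw [← L.deriv_weierstrassP]
      exact (L.analyticOnNhd_weierstrassP (Ω + v) hv).differentiableAt.hasDerivAt
    rw [((h℘.comp_const_add Ω v).sub_const (W.b₂ / 12)).deriv]
    ring
  have hF := analyticAt_x_translate L W hΩ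
  have hG := analyticAt_y_translate L W hΩ
  have h2G : AnalyticAt ℂ (fun v : ℂ => 2 * ((℘'[L] (Ω + v) - W.a₁ * (℘[L] (Ω + v) - W.b₂ / 12) - W.a₃) / 2)) 0 :=
    analyticAt_const.mul hG
  have haF : AnalyticAt ℂ (fun v : ℂ => W.a₁ * (℘[L] (Ω + v) - W.b₂ / 12)) 0 := analyticAt_const.mul hF
  rw [taylor_congr hev]
  have e : (fun v => 2 * ((℘'[L] (Ω + v) - W.a₁ * (℘[L] (Ω + v) - W.b₂ / 12) - W.a₃) / 2) + W.a₁ * (℘[L] (Ω + v) - W.b₂ / 12) + W.a₃) =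
      ((fun v => 2 * ((℘'[L] (Ω + v) - W.a₁ * (℘[L] (Ω + v) - W.b₂ / 12) - W.a₃) / 2)) +
        fun v => W.a₁ * (℘[L] (Ω + v) - W.b₂ / 12)) + fun _ => W.a₃ := by
    funext v; simp only [Pi.add_apply]
  rw [e, taylor_add (h2G.add haF) analyticAt_const, taylor_add h2G haF, taylor_const_mul, taylor_const_mul, taylor_const, map_ofNat]

/-- ★ **`d/dz (translateX ∘ exp_W) = 2·(translateY ∘ exp_W) + a₁·(translateX ∘ exp_W) + a₃`** at `P₁ = ξ(Ω)` (`Ω ∉ Λ`, `℘′(Ω) ≠ 0`):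
the invariant derivative `dx/ω = 2y + a₁x + a₃` on the translate of the formal group, in the logarithmic coordinate.
[cite: SilvermanAEC2009, III.1, IV.1, VI.3.6] -/
theorem derivative_translateX_subst_formalExp [W.IsElliptic] (h₂ : L.g₂ = W.c₄ / 12) (h₃ : L.g₃ = W.c₆ / 216) {Ω : ℂ}
    (hΩ : Ω ∉ L.lattice) (hΩ' : ℘'[L] Ω ≠ 0) :
    d⁄dX ℂ ((W.translateX (℘[L] Ω - W.b₂ / 12) ((℘'[L] Ω - W.a₁ * (℘[L] Ω - W.b₂ / 12) - W.a₃) / 2)).subst W.formalExp) =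
      2 * (W.translateY (℘[L] Ω - W.b₂ / 12) ((℘'[L] Ω - W.a₁ * (℘[L] Ω - W.b₂ / 12) - W.a₃) / 2)).subst W.formalExp +
        C W.a₁ * (W.translateX (℘[L] Ω - W.b₂ / 12) ((℘'[L] Ω - W.a₁ * (℘[L] Ω - W.b₂ / 12) - W.a₃) / 2)).subst W.formalExp +
        C W.a₃ := by
  rw [← taylor_weierstrassP_add_sub_eq_translateX_subst_formalExp L W h₂ h₃ hΩ,
    ← taylor_y_translate_eq_translateY_subst_formalExp L W h₂ h₃ hΩ hΩ']
  exact derivative_taylor_x_translate L W hΩ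

/-- ★★★ **The CM transformation identity, `y`-coordinate, logarithmic coordinate.**  With `TXᵢ, TYᵢ` the translate series `∘ exp_W` at
`ξ(Ω)` (`i = 0`) and `ξ(αΩ)` (`i = 1`), `S = TX₀ + C b`, `ỹᵢ = 2TYᵢ + a₁TXᵢ + a₃`:
**`α·(2·rescale α TY₁ + a₁·rescale α TX₁ + a₃)·Q(S) + (rescale α TX₁ + C b)·Q′(S)·ỹ₀ = P′(S)·ỹ₀`** — the derivative of the `x`-identity
`(rescale α TX₁ + C b)·Q(S) = P(S)`; it is `α·℘′(α(Ω+v))·Q² = (P′Q − PQ′)·℘′(Ω+v)` on Taylor series, i.e. the `y`-chart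
`y ↦ (P′Q − PQ′)(℘)·ỹ/(αQ²)` of `[α]` matches the formal `[α]_Ê` on `P₁ ⊕ E₁`. [cite: SilvermanATAEC1994, II Prop. 1.1] [cite: Cox2013, Prop. 14.9]
[cite: deShalit1987, II §1.10, §4.9] -/
theorem rescale_translateY_cm_identity [W.IsElliptic] (h₂ : L.g₂ = W.c₄ / 12) (h₃ : L.g₃ = W.c₆ / 216) {α : ℂ}
    {P Q : Polynomial ℂ}
    (hR : ∀ z : ℂ, α * z ∉ L.lattice → Q.eval (℘[L] z) ≠ 0 ∧ ℘[L] (α * z) = P.eval (℘[L] z) / Q.eval (℘[L] z))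
    {Ω : ℂ} (hΩ : Ω ∉ L.lattice) (hαΩ : α * Ω ∉ L.lattice) (hΩ' : ℘'[L] Ω ≠ 0) (hαΩ' : ℘'[L] (α * Ω) ≠ 0) :
    C α * (2 * rescale α ((W.translateY (℘[L] (α * Ω) - W.b₂ / 12)
            ((℘'[L] (α * Ω) - W.a₁ * (℘[L] (α * Ω) - W.b₂ / 12) - W.a₃) / 2)).subst W.formalExp) +
          C W.a₁ * rescale α ((W.translateX (℘[L] (α * Ω) - W.b₂ / 12)
            ((℘'[L] (α * Ω) - W.a₁ * (℘[L] (α * Ω) - W.b₂ / 12) - W.a₃) / 2)).subst W.formalExp) + C W.a₃) *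
        Polynomial.aeval ((W.translateX (℘[L] Ω - W.b₂ / 12) ((℘'[L] Ω - W.a₁ * (℘[L] Ω - W.b₂ / 12) - W.a₃) / 2)).subst
          W.formalExp + C (W.b₂ / 12)) Q +
      (rescale α ((W.translateX (℘[L] (α * Ω) - W.b₂ / 12)
            ((℘'[L] (α * Ω) - W.a₁ * (℘[L] (α * Ω) - W.b₂ / 12) - W.a₃) / 2)).subst W.formalExp) + C (W.b₂ / 12)) *
        Polynomial.aeval ((W.translateX (℘[L] Ω - W.b₂ / 12) ((℘'[L] Ω - W.a₁ * (℘[L] Ω - W.b₂ / 12) - W.a₃) / 2)).subst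
          W.formalExp + C (W.b₂ / 12)) (Polynomial.derivative Q) *
        (2 * (W.translateY (℘[L] Ω - W.b₂ / 12) ((℘'[L] Ω - W.a₁ * (℘[L] Ω - W.b₂ / 12) - W.a₃) / 2)).subst W.formalExp +
          C W.a₁ * (W.translateX (℘[L] Ω - W.b₂ / 12) ((℘'[L] Ω - W.a₁ * (℘[L] Ω - W.b₂ / 12) - W.a₃) / 2)).subst W.formalExp +
          C W.a₃) =
      Polynomial.aeval ((W.translateX (℘[L] Ω - W.b₂ / 12) ((℘'[L] Ω - W.a₁ * (℘[L] Ω - W.b₂ / 12) - W.a₃) / 2)).subst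
          W.formalExp + C (W.b₂ / 12)) (Polynomial.derivative P) *
        (2 * (W.translateY (℘[L] Ω - W.b₂ / 12) ((℘'[L] Ω - W.a₁ * (℘[L] Ω - W.b₂ / 12) - W.a₃) / 2)).subst W.formalExp +
          C W.a₁ * (W.translateX (℘[L] Ω - W.b₂ / 12) ((℘'[L] Ω - W.a₁ * (℘[L] Ω - W.b₂ / 12) - W.a₃) / 2)).subst W.formalExp +
          C W.a₃) := by
  have hA := rescale_translateX_subst_formalExp_mul_aeval_eq L W h₂ h₃ hR hΩ hαΩ
  have hD₀ := derivative_translateX_subst_formalExp L W h₂ h₃ hΩ hΩ'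
  have hD₁ := derivative_translateX_subst_formalExp L W h₂ h₃ hαΩ hαΩ'
  set TX₀ := (W.translateX (℘[L] Ω - W.b₂ / 12) ((℘'[L] Ω - W.a₁ * (℘[L] Ω - W.b₂ / 12) - W.a₃) / 2)).subst W.formalExp
  set TY₀ := (W.translateY (℘[L] Ω - W.b₂ / 12) ((℘'[L] Ω - W.a₁ * (℘[L] Ω - W.b₂ / 12) - W.a₃) / 2)).subst W.formalExp
  set TX₁ := (W.translateX (℘[L] (α * Ω) - W.b₂ / 12) ((℘'[L] (α * Ω) - W.a₁ * (℘[L] (α * Ω) - W.b₂ / 12) - W.a₃) / 2)).subst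
    W.formalExp
  set TY₁ := (W.translateY (℘[L] (α * Ω) - W.b₂ / 12) ((℘'[L] (α * Ω) - W.a₁ * (℘[L] (α * Ω) - W.b₂ / 12) - W.a₃) / 2)).subst
    W.formalExp
  set S := TX₀ + C (W.b₂ / 12) with hS
  -- differentiate the `x`-identity
  have hd := congrArg (d⁄dX ℂ) hA
  have hdS : d⁄dX ℂ S = 2 * TY₀ + C W.a₁ * TX₀ + C W.a₃ := by rw [hS, map_add, derivative_C, add_zero, hD₀]
  have hd1 : d⁄dX ℂ (rescale α TX₁ + C (W.b₂ / 12)) = C α * (2 * rescale α TY₁ + C W.a₁ * rescale α TX₁ + C W.a₃) := by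
    rw [map_add, derivative_C, add_zero, derivative_rescale_C_mul, hD₁, map_add, map_add, map_mul, map_mul, rescale_C', rescale_C',
      map_ofNat]
  rw [(d⁄dX ℂ).leibniz, Derivation.map_aeval, Derivation.map_aeval, hdS, hd1, smul_eq_mul, smul_eq_mul, smul_eq_mul,
    smul_eq_mul] at hd
  linear_combination hd

/-! ## The `y`-identity in the formal-group coordinate (cancel `exp_W`) -/

omit L in
/-- `(F ∘ [α]_Ê) ∘ exp_W = rescale α (F ∘ exp_W)` (`[α]_Ê ∘ exp_W = exp_W ∘ (α·)`). [cite: SilvermanAEC2009, IV.5] -/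
theorem subst_formalMulBy_subst_formalExp_eq_rescale (α : ℂ) (F : PowerSeries ℂ) :
    PowerSeries.subst W.formalExp (PowerSeries.subst (PowerSeries.subst (C α * W.formalLog) W.formalExp) F) =
      rescale α (PowerSeries.subst W.formalExp F) := by
  have hexp : HasSubst W.formalExp := HasSubst.of_constantCoeff_zero' W.constantCoeff_formalExp
  have hmul0 : constantCoeff (PowerSeries.subst (C α * W.formalLog) W.formalExp) = 0 :=
    constantCoeff_subst_eq_zero (a := C α * W.formalLog) (by
      change PowerSeries.constantCoeff (C α * W.formalLog) = 0
      rw [map_mul, W.constantCoeff_formalLog, mul_zero]) _ W.constantCoeff_formalExp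
  rw [subst_comp_subst_apply (HasSubst.of_constantCoeff_zero' hmul0) hexp, ← rescale_formalExp_eq_subst W α, rescale_eq_subst,
    rescale_eq_subst, subst_comp_subst_apply hexp (HasSubst.smul_X' α)]

/-- ★★★ **The CM transformation identity, `y`-coordinate, formal-group coordinate**: with `[α]_Ê = exp_W ∘ (α·log_W)`,
`X₁ = translateX(ξ(αΩ)) ∘ [α]_Ê`, `Y₁ = translateY(ξ(αΩ)) ∘ [α]_Ê`, `X₀ = translateX(ξ Ω)`, `Y₀ = translateY(ξ Ω)`, `S = X₀ + C b`, `ỹ₀ = 2Y₀ + a₁X₀ + a₃`: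
**`α·(2Y₁ + a₁X₁ + a₃)·Q(S) + (X₁ + C b)·Q′(S)·ỹ₀ = P′(S)·ỹ₀`** in `ℂ⟦t⟧` — `ỹ(ξ(αΩ) ⊕ P([α]_Ê t))·α·Q² = (P′Q − PQ′)(x + b)·ỹ(ξ Ω ⊕ P(t))`:
the `y`-chart of the algebraic `[α]` is computed by the formal `[α]_Ê` on `P₁ ⊕ E₁`. [cite: SilvermanATAEC1994, II Prop. 1.1]
[cite: deShalit1987, II §1.10, §4.9] [cite: Cox2013, Prop. 14.9] -/
theorem translateY_cm_identity [W.IsElliptic] (h₂ : L.g₂ = W.c₄ / 12) (h₃ : L.g₃ = W.c₆ / 216) {α : ℂ} {P Q : Polynomial ℂ}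
    (hR : ∀ z : ℂ, α * z ∉ L.lattice → Q.eval (℘[L] z) ≠ 0 ∧ ℘[L] (α * z) = P.eval (℘[L] z) / Q.eval (℘[L] z))
    {Ω : ℂ} (hΩ : Ω ∉ L.lattice) (hαΩ : α * Ω ∉ L.lattice) (hΩ' : ℘'[L] Ω ≠ 0) (hαΩ' : ℘'[L] (α * Ω) ≠ 0) :
    C α * (2 * PowerSeries.subst (PowerSeries.subst (C α * W.formalLog) W.formalExp)
            (W.translateY (℘[L] (α * Ω) - W.b₂ / 12) ((℘'[L] (α * Ω) - W.a₁ * (℘[L] (α * Ω) - W.b₂ / 12) - W.a₃) / 2)) +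
          C W.a₁ * PowerSeries.subst (PowerSeries.subst (C α * W.formalLog) W.formalExp)
            (W.translateX (℘[L] (α * Ω) - W.b₂ / 12) ((℘'[L] (α * Ω) - W.a₁ * (℘[L] (α * Ω) - W.b₂ / 12) - W.a₃) / 2)) + C W.a₃) *
        Polynomial.aeval (W.translateX (℘[L] Ω - W.b₂ / 12) ((℘'[L] Ω - W.a₁ * (℘[L] Ω - W.b₂ / 12) - W.a₃) / 2) + C (W.b₂ / 12)) Q +
      (PowerSeries.subst (PowerSeries.subst (C α * W.formalLog) W.formalExp)
            (W.translateX (℘[L] (α * Ω) - W.b₂ / 12) ((℘'[L] (α * Ω) - W.a₁ * (℘[L] (α * Ω) - W.b₂ / 12) - W.a₃) / 2)) +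
          C (W.b₂ / 12)) *
        Polynomial.aeval (W.translateX (℘[L] Ω - W.b₂ / 12) ((℘'[L] Ω - W.a₁ * (℘[L] Ω - W.b₂ / 12) - W.a₃) / 2) + C (W.b₂ / 12))
          (Polynomial.derivative Q) *
        (2 * W.translateY (℘[L] Ω - W.b₂ / 12) ((℘'[L] Ω - W.a₁ * (℘[L] Ω - W.b₂ / 12) - W.a₃) / 2) +
          C W.a₁ * W.translateX (℘[L] Ω - W.b₂ / 12) ((℘'[L] Ω - W.a₁ * (℘[L] Ω - W.b₂ / 12) - W.a₃) / 2) + C W.a₃) =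
      Polynomial.aeval (W.translateX (℘[L] Ω - W.b₂ / 12) ((℘'[L] Ω - W.a₁ * (℘[L] Ω - W.b₂ / 12) - W.a₃) / 2) + C (W.b₂ / 12))
          (Polynomial.derivative P) *
        (2 * W.translateY (℘[L] Ω - W.b₂ / 12) ((℘'[L] Ω - W.a₁ * (℘[L] Ω - W.b₂ / 12) - W.a₃) / 2) +
          C W.a₁ * W.translateX (℘[L] Ω - W.b₂ / 12) ((℘'[L] Ω - W.a₁ * (℘[L] Ω - W.b₂ / 12) - W.a₃) / 2) + C W.a₃) := by
  have hexp : HasSubst W.formalExp := HasSubst.of_constantCoeff_zero' W.constantCoeff_formalExp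
  have hlog := rescale_translateY_cm_identity L W h₂ h₃ hR hΩ hαΩ hΩ' hαΩ'
  apply subst_formalExp_injective W
  rw [← coe_substAlgHom hexp]
  simp only [map_mul, map_add, map_ofNat, Literature.NumberTheory.EllipticCurves.substAlgHom_C, ← Polynomial.aeval_algHom_apply]
  simp only [coe_substAlgHom hexp, subst_formalMulBy_subst_formalExp_eq_rescale]
  exact hlog

end WeierstrassCurve

end
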